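import Literature.Analysis.FluidPDE.NSCriticalClosureReduced
import Literature.Analysis.FluidPDE.ESSLocalHolderNoConcentration
import HarnessLib

/-!
# The `L³` continuation criterion from the higher interior regularity of bounded weak solutions

Analysis/FluidPDE proofs-only file (theorems only: no definitions, no named facts) on the
discharge path of the named fact
`Literature.Analysis.FluidPDE.hasSmoothExtensionPast_of_eLpNorm_three_bounded`
(`NSCriticalClosure.lean`; G. Seregin, Comm. Math. Phys. 312 (2012) 833–845, Thm. 1.1, in the
`limsup` form of L. Escauriaza, G. Seregin, V. Šverák, Russ. Math. Surveys 58:2 (2003) 211–250,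
Thm. 1.3 with §3 (3.5)–(3.6): a classical Leray–Hopf solution from a rapidly decaying datum whose
`L³` norm stays bounded on `[0, T)` extends smoothly past `T`).

State of the cone (2026-08-15). Every assembly of the fact in the tree
(`NSCriticalClosureProofs/Tao/Bounded/Reduced/Tao2021.lean`) consumes ESS (3.6)
(`ess_sup_bound`), which the accepted `ess_sup_bound_of_local_holder`
(`NSEssEndpointReduced.lean`) reduces to ESS Thm. 1.4 (`ess_local_holder`); and the accepted
`ess_local_holder_of_higherRegularityBounds` (`ESSLocalHolderNoConcentration.lean`: the covering
step, the proved ε-regularity `ess_epsilon_regularity'_holds`, the blow-up limit, CKN, the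
class-`C¹₂` Carleman theorems and the harmonic Liouville theorem, all proved) reduces Thm. 1.4 to
the single pre-existing named fact `NSBoundedHigherRegularityBounds`
(`NSBoundedHigherRegularityQuant.lean`: Serrin 1962 / Seregin–Šverák 2009 §2 p. 8 — all spatial
derivatives of an essentially bounded distributional solution are bounded and Hölder continuous
in the interior, with constants depending on the data only). This file records the two resulting
one-hypothesis compositions, so that the discharge
`hasSmoothExtensionPast_of_eLpNorm_three_bounded_holds` is the term
`hasSmoothExtensionPast_of_eLpNorm_three_bounded_of_higherRegularityBounds
NSBoundedHigherRegularityBounds_holds` the moment that fact is discharged: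

* `ess_sup_bound_of_higherRegularityBounds : NSBoundedHigherRegularityBounds → ess_sup_bound`;
* `hasSmoothExtensionPast_of_eLpNorm_three_bounded_of_higherRegularityBounds :
    NSBoundedHigherRegularityBounds → hasSmoothExtensionPast_of_eLpNorm_three_bounded`.

Nothing accepted is restated or changed; no `sorry`; no new named fact (D-0026).

## References

* G. Seregin, *A certain necessary condition of potential blow up for Navier–Stokes equations*,
  Comm. Math. Phys. 312 (2012) 833–845 = arXiv:1104.3615, Thm. 1.1. [`Seregin2012CMP`]
* L. Escauriaza, G. Seregin, V. Šverák, *`L_{3,∞}`-solutions of Navier–Stokes equations and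
  backward uniqueness*, Russ. Math. Surveys 58:2 (2003) 211–250, Thms. 1.3–1.4, §3 (3.5)–(3.6).
  [`EscauriazaSereginSverak2003`]
* G. Seregin, V. Šverák, Comm. PDE 34 (2009) 171–201 = arXiv:0804.1803, §2 p. 8;
  J. Serrin, Arch. Rational Mech. Anal. 9 (1962) 187–195. [`SereginSverak2009`, `Serrin1962`]
-/

noncomputable section

namespace Literature.Analysis.FluidPDE

/-- **ESS (3.5)–(3.6) from the higher interior regularity of bounded weak solutions**:
`ess_sup_bound` (boundedness away from `t = 0` of `L_{3,∞}` Leray–Hopf solutions of the Cauchy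
problem, ESS 2003 §3 (3.6)) follows from `NSBoundedHigherRegularityBounds` alone — the accepted
`ess_sup_bound_of_local_holder` (Thm. 1.4 ⇒ (3.6)) composed with
`ess_local_holder_of_higherRegularityBounds` (Thm. 1.4 from Serrin's quantitative interior
regularity, everything else proved). [cite: EscauriazaSereginSverak2003, Thm. 1.3, §3 (3.5)–(3.6), with Thm. 1.4] -/
theorem ess_sup_bound_of_higherRegularityBounds (hB : NSBoundedHigherRegularityBounds) :
    ess_sup_bound :=
  ess_sup_bound_of_local_holder (ess_local_holder_of_higherRegularityBounds hB)

/-- **Seregin 2012, Thm. 1.1 (`limsup` form, ESS 2003 Thm. 1.3) as a continuation criterion, from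
the higher interior regularity of bounded weak solutions**: the named fact
`hasSmoothExtensionPast_of_eLpNorm_three_bounded` follows from `NSBoundedHigherRegularityBounds`
alone — the accepted `hasSmoothExtensionPast_of_eLpNorm_three_bounded_of_ess_local_holder`
(ESS Thm. 1.4 ⇒ (3.6) ⇒ pointwise bound on `(δ, T) × ℝ³` ⇒ Leray's continuation of bounded
classical solutions, `hasSmoothExtensionPast_of_bounded_holds`) composed with
`ess_local_holder_of_higherRegularityBounds`. The discharge `…_holds` is this theorem applied to
`NSBoundedHigherRegularityBounds_holds` once Serrin's quantitative interior regularity is proved.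
[cite: Seregin2012CMP, Thm. 1.1] [cite: EscauriazaSereginSverak2003, Thms. 1.3–1.4, §3 (3.5)–(3.6)] -/
theorem hasSmoothExtensionPast_of_eLpNorm_three_bounded_of_higherRegularityBounds
    (hB : NSBoundedHigherRegularityBounds) : hasSmoothExtensionPast_of_eLpNorm_three_bounded :=
  hasSmoothExtensionPast_of_eLpNorm_three_bounded_of_ess_local_holder
    (ess_local_holder_of_higherRegularityBounds hB)

end Literature.Analysis.FluidPDE

end
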